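import Summits.CriticalPhenomena.Ising3D.TaylorCoeffZMonoHalf
import HarnessLib

/-!
# Kernel-evaluation recipe for the q-polynomial closed forms at rational points (feasibility for the TABLE theorem)
(cell `pub-ising3x`, seat boot-1; gate (g2)/(g3): how a Lean checker evaluates the numbers of a derivative certificate)

HONEST FRAMING: lottery ticket; floor = tightest certified 3D Ising CFT bounds; no exact-solution
claim without a proof.

The closed forms of `TaylorCoeffZMonoHalf` / `TaylorRegionQPoly` are finite sums of products of generalised
binomial coefficients `Ring.choose (r : ℝ) n` at RATIONAL `r` (external dimensions, `(E-j)/2 + p`) and of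
`legendreLam i = C(2i,i)/4^i`. Mathlib's `norm_num` has no `Ring.choose` extension, but the tree's
`choose_eq_ascPochhammer_div` (`Ring.choose a n = (ascPochhammer ℝ n).eval (a-n+1) / n!`, TaylorGermOneVar)
followed by `ascPochhammer_succ_eval` unfolds it to a rational product that `norm_num` closes. The theorems
below are the worked recipe (simp set: `qFactor₁/₂`, `Finset.Nat.antidiagonal_succ/zero`, `Finset.sum_cons`,
`Finset.sum_map`, `Finset.sum_singleton`, `choose_eq_ascPochhammer_div`; then
`norm_num [ascPochhammer_succ_eval, ascPochhammer_zero, Nat.factorial]`; for `legendreLam` (e.g. `legendreLam_four`; `legendreLam_two` is in the tree):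
`Nat.centralBinom_eq_two_mul_choose`, `Nat.choose`). So the per-box checks of a kind-`deriv` table can be
discharged by `norm_num` at rational corner/centre points (interval enclosures = two such evaluations plus a
monotonicity or Lipschitz lemma), no `native_decide`. Elementary.
-/

namespace Summit.CriticalPhenomena.Ising3D

open Finset
open Literature.MathematicalPhysics.QuantumFieldTheory.ConformalBootstrap3D

/-- `C(1/2, 2) = -1/8`, by the recipe. [folklore] -/
theorem choose_half_two : Ring.choose (1 / 2 : ℝ) 2 = -1 / 8 := by
  rw [choose_eq_ascPochhammer_div]
  norm_num [ascPochhammer_succ_eval, ascPochhammer_zero, Nat.factorial]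

/-- `C(13/10, 3) = -91/2000`, by the recipe. [folklore] -/
theorem choose_thirteenTenths_three : Ring.choose (13 / 10 : ℝ) 3 = -91 / 2000 := by
  rw [choose_eq_ascPochhammer_div]
  norm_num [ascPochhammer_succ_eval, ascPochhammer_zero, Nat.factorial]

/-- `q¹(1/2, 3/4; 2) = C(3/4,2) - C(1/2,1)C(3/4,1) + C(1/2,2) = -19/32`, by the recipe. [folklore] -/
theorem qFactor₁_half_threeQuarters_two : qFactor₁ (1 / 2 : ℝ) (3 / 4) 2 = -19 / 32 := by
  simp only [qFactor₁, Finset.Nat.antidiagonal_succ, Finset.Nat.antidiagonal_zero, Finset.sum_cons,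
    Finset.sum_map, Finset.sum_singleton, choose_eq_ascPochhammer_div]
  norm_num [ascPochhammer_succ_eval, ascPochhammer_zero, Nat.factorial]

/-- `q²(1/2, 3/4; 2) = C(1/2,2) - C(1/2,1)C(3/4,1) + C(3/4,2) = -19/32` as well (the two factors are symmetric
under `s ↔ α` up to the sign pattern; here equal by coincidence of the formula at order 2). [folklore] -/
theorem qFactor₂_half_threeQuarters_two : qFactor₂ (1 / 2 : ℝ) (3 / 4) 2 = -19 / 32 := by
  simp only [qFactor₂, Finset.Nat.antidiagonal_succ, Finset.Nat.antidiagonal_zero, Finset.sum_cons,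
    Finset.sum_map, Finset.sum_singleton, choose_eq_ascPochhammer_div]
  norm_num [ascPochhammer_succ_eval, ascPochhammer_zero, Nat.factorial]

/-- `λ₄ = C(8,4)/256 = 35/128`, by the recipe (`λ₂ = 3/8` is the tree's `legendreLam_two`). [folklore] -/
theorem legendreLam_four : legendreLam 4 = 35 / 128 := by
  norm_num [legendreLam, Nat.centralBinom_eq_two_mul_choose, Nat.choose]

end Summit.CriticalPhenomena.Ising3D
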